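import Summits.Schanuel.Schanuel.Theorems.SoloInformedBoxFloor

/-!
# Proposition BE — exact box dimensions under a principal relation ideal; the quantised ladder

Solo programme `solo-Schanuel-informed` (verdict NO PATH unchanged; a verdict-neutral
sharpening of Proposition BD, `SoloInformedBoxDimension` / `SoloInformedBoxFloor`: "typed and
measured, not a mechanism").  Notation as there: `Box_d(x) = {∏ᵢ xᵢ^{fᵢ} : 0 ≤ fᵢ ≤ d}`
(`boxMonomial x d`), `dim Box_d(x)` the `ℚ`-dimension of its span.

## Statements (all sorry-free)

* §1–§2 bookkeeping: `boxPoly` (the polynomial of a box-coefficient vector) and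
  `eq_subboxPoly_of_degreeOf_le` (reconstruction from sub-box coefficients).
* §3 `relationIdeal x = ker (Q ↦ Q(x)) ⊂ ℚ[X₁,…,Xₙ]`; "`P` generates" means `relationIdeal x = (P)`,
  i.e. `P(x) = 0` and `P` divides every relation (`relationIdeal_eq_span_iff`).
  EXACTNESS `finrank_span_box_add_eq_of_generator`: if `P ≠ 0` generates and has multidegree
  `a ≤ (d,…,d)`, then `dim Box_d(x) + ∏ᵢ (d + 1 − aᵢ) = (d + 1)ⁿ` — the cap of Proposition BD
  is attained: every relation inside the box is `P·H`, `H` in the sub-box `∏ [0, d − aᵢ]`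
  (`exists_relationMap_eq_of_relation`; degrees add in the domain `ℚ[X]`, Mathlib
  `MvPolynomial.degreeOf_mul_eq`).  FREENESS `box_linearIndependent_iff_of_generator`:
  `Box_d(x)` is `ℚ`-free iff `∃ i, d < aᵢ`.  `exists_pos_degreeOf_of_relation`: at a point with
  transcendental `j`-th coordinate a nonzero relation involves a variable other than `X_j`.
* §4 two variables: `finrank_span_box_eq_of_generator_two` (`dim Box_d = (a+b)(d+1) − ab` for
  `d ≥ a, b`), `quantised_mem_window` (`2d+1 ≤ (a+b)(d+1) − ab ≤ (d+1)² − 1` for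
  `1 ≤ a, b ≤ d`); at `(e, π)`: `one_le_bidegree_of_expOnePi_relation` (`a, b ≥ 1`),
  `box_expOnePi_linearIndependent_iff_of_generator` (`Box_d` free iff `d < max(a,b)`),
  `bilinearFloor_iff_of_expOnePi_generator` (`BilinearFloor ⟺ max(a,b) ≥ 2`), and the DICHOTOMY
  `expOnePi_box_dichotomy_of_principal`: granting that the relation ideal of `(e, π)` is
  principal (`Submodule.IsPrincipal`, a hypothesis), EITHER `e ⟂ π` OR there are `a, b ≥ 1` with
  `dim Box_d(e, π) = (a+b)(d+1) − ab` for all `d ≥ max(a,b)`.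

## Reading

Proposition BD gave the window `2d + 1 ≤ dim Box_d(e,π) ≤ (d+1)²` and the cap `(a+b)(d+1) − ab`
under a relation of bidegree `≤ (a,b)`; here the cap is the exact value when the relation
GENERATES: unless `e ⟂ π`, the box dimensions at `(e, π)` are eventually linear in `d` with slope
`a + b ≥ 2` (floor `2d + 1` = bilinear generator).  The one non-kernel input is the principality
of the relation ideal of `(e, π)` (`e` transcendental ⟹ a prime of height `≤ 1` in the UFD
`ℚ[X, Y]`, hence `0` or principal [Matsumura1986, Thm 20.1]), carried as an explicit hypothesis.
What is NOT here: no information about which case holds; the file proves implications only.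

## References

* [Nesterenko1985] Yu. V. Nesterenko, *On the linear independence of numbers*, Moscow Univ.
  Math. Bull. 40 (1985), 69–74 — the criterion behind the doors of Proposition BD.
* [Matsumura1986] H. Matsumura, *Commutative Ring Theory*, CUP 1986, Thm 20.1 (UFD ⟺ every
  height-one prime is principal).
-/

noncomputable section

open Finset
open Literature.NumberTheory.Transcendental (ExpOnePiAlgebraicIndependent transcendental_exp_one
  transcendental_pi transcendental_exp_one_holds transcendental_pi_holds)

namespace Summit.Schanuel.Schanuel.Theorems

/-! ### §1 The box polynomial of a coefficient vector -/

section BoxPoly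

variable {n : ℕ}

/-- The polynomial `∑_f g_f · X^{boxExp f}` with a given box-coefficient vector `g`. -/
def boxPoly (d : ℕ) (g : (Fin n → Fin (d + 1)) → ℚ) : MvPolynomial (Fin n) ℚ :=
  ∑ f, MvPolynomial.monomial (boxExp d f) (g f)

/-- A box polynomial has partial degrees `≤ d`. -/
theorem degreeOf_boxPoly_le (d : ℕ) (g : (Fin n → Fin (d + 1)) → ℚ) (i : Fin n) :
    (boxPoly d g).degreeOf i ≤ d :=
  degreeOf_sum_monomial_le (boxExp d) g fun f => by
    rw [boxExp_apply]; exact Nat.le_of_lt_succ (f i).is_lt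

/-- The box coefficients of the box polynomial of `g` are `g`. -/
theorem boxCoeff_boxPoly (d : ℕ) (g : (Fin n → Fin (d + 1)) → ℚ) :
    boxCoeff d (boxPoly d g) = g := by
  funext f
  exact coeff_sum_monomial_of_injective (boxExp_injective d) g f

/-- The value of the box polynomial of `g` at `x` is the box combination with coefficients `g`. -/
theorem aeval_boxPoly (x : Fin n → ℝ) (d : ℕ) (g : (Fin n → Fin (d + 1)) → ℚ) :
    MvPolynomial.aeval x (boxPoly d g) = Fintype.linearCombination ℚ (boxMonomial x d) g := by
  rw [← linearCombination_boxCoeff x d (degreeOf_boxPoly_le d g), boxCoeff_boxPoly]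

end BoxPoly

/-! ### §2 Reconstruction of a sub-box polynomial from its coefficients -/

section SubBox

variable {n : ℕ}

/-- Every exponent vector inside the sub-box `∏ [0, d − aᵢ]` is a sub-box exponent. -/
theorem exists_subboxExp_eq {d : ℕ} {a : Fin n → ℕ} (had : ∀ i, a i ≤ d) {m : Fin n →₀ ℕ}
    (hm : ∀ i, m i ≤ d - a i) : ∃ h : (i : Fin n) → Fin (d + 1 - a i), subboxExp d a h = m :=
  ⟨fun i => ⟨m i, by have := hm i; have := had i; omega⟩, by ext i; simp⟩

/-- A polynomial of partial degrees `≤ d − aᵢ` is the sub-box polynomial of its coefficients. -/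
theorem eq_subboxPoly_of_degreeOf_le {d : ℕ} {a : Fin n → ℕ} (had : ∀ i, a i ≤ d)
    {H : MvPolynomial (Fin n) ℚ} (hH : ∀ i, H.degreeOf i ≤ d - a i) :
    H = subboxPoly d a fun h => H.coeff (subboxExp d a h) := by
  classical
  rw [subboxPoly_apply]
  ext m
  by_cases hm : ∀ i, m i ≤ d - a i
  · obtain ⟨h, rfl⟩ := exists_subboxExp_eq had hm
    exact (coeff_sum_monomial_of_injective (subboxExp_injective d a)
      (fun h' => H.coeff (subboxExp d a h')) h).symm
  · push Not at hm
    obtain ⟨i, hi⟩ := hm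
    rw [coeff_sum_monomial_eq_zero (subboxExp d a) _ fun h hh => ?_]
    · by_contra hc
      have := (MvPolynomial.monomial_le_degreeOf i (MvPolynomial.mem_support_iff.mpr hc)).trans
        (hH i)
      omega
    · have h1 : (subboxExp d a h) i = m i := by rw [hh]
      rw [subboxExp_apply] at h1
      have := (h i).is_lt
      omega

end SubBox

/-! ### §3 Principal relation ideals: the cap is attained -/

section Generator

variable {n : ℕ}

/-- The RELATION IDEAL of `x ∈ ℝⁿ` over `ℚ`: the kernel of `Q ↦ Q(x)` on `ℚ[X₁,…,Xₙ]`. -/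
def relationIdeal (x : Fin n → ℝ) : Ideal (MvPolynomial (Fin n) ℚ) :=
  RingHom.ker (MvPolynomial.aeval x : MvPolynomial (Fin n) ℚ →ₐ[ℚ] ℝ)

/-- Membership in the relation ideal is vanishing at `x`. -/
theorem mem_relationIdeal_iff {x : Fin n → ℝ} {R : MvPolynomial (Fin n) ℚ} :
    R ∈ relationIdeal x ↔ MvPolynomial.aeval x R = 0 := RingHom.mem_ker

/-- `P` GENERATES the relation ideal (`relationIdeal x = (P)`) iff `P(x) = 0` and `P` divides
every relation.  (`P = 0` is allowed: then `x` is algebraically independent,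
`relationIdeal_eq_bot_iff`.) -/
theorem relationIdeal_eq_span_iff (x : Fin n → ℝ) (P : MvPolynomial (Fin n) ℚ) :
    relationIdeal x = Ideal.span {P} ↔
      MvPolynomial.aeval x P = 0 ∧
        ∀ R : MvPolynomial (Fin n) ℚ, MvPolynomial.aeval x R = 0 → P ∣ R := by
  constructor
  · intro h
    have hmem : ∀ R : MvPolynomial (Fin n) ℚ, MvPolynomial.aeval x R = 0 ↔ P ∣ R := fun R => by
      rw [← Ideal.mem_span_singleton, ← h, mem_relationIdeal_iff]
    exact ⟨(hmem P).mpr dvd_rfl, fun R hR => (hmem R).mp hR⟩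
  · rintro ⟨hPx, hgen⟩
    ext R
    rw [mem_relationIdeal_iff, Ideal.mem_span_singleton]
    refine ⟨fun hR => hgen R hR, fun ⟨H, hH⟩ => ?_⟩
    rw [hH, map_mul, hPx, zero_mul]

/-- The relation ideal is `0` iff the point is algebraically independent. -/
theorem relationIdeal_eq_bot_iff (x : Fin n → ℝ) :
    relationIdeal x = ⊥ ↔ AlgebraicIndependent ℚ x := by
  rw [relationIdeal, algebraicIndependent_iff_injective_aeval, RingHom.injective_iff_ker_eq_bot]

/-- **Every relation in the box is `P · (sub-box polynomial)`.**  If `P ≠ 0` has multidegree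
`a` and divides every relation of `x`, then every `g` in the kernel of the box combination is in
the image of the relation map of `P`. -/
theorem exists_relationMap_eq_of_relation {x : Fin n → ℝ} {d : ℕ} {a : Fin n → ℕ}
    (had : ∀ i, a i ≤ d) {P : MvPolynomial (Fin n) ℚ} (hP : P ≠ 0)
    (hPa : ∀ i, P.degreeOf i = a i)
    (hgen : ∀ R : MvPolynomial (Fin n) ℚ, MvPolynomial.aeval x R = 0 → P ∣ R)
    {g : (Fin n → Fin (d + 1)) → ℚ} (hg : Fintype.linearCombination ℚ (boxMonomial x d) g = 0) :
    ∃ c : ((i : Fin n) → Fin (d + 1 - a i)) → ℚ, relationMap d a P c = g := by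
  classical
  obtain ⟨H, hH⟩ := hgen (boxPoly d g) (by rw [aeval_boxPoly, hg])
  by_cases hH0 : H = 0
  · refine ⟨0, ?_⟩
    rw [map_zero, ← boxCoeff_boxPoly d g, hH, hH0, mul_zero, map_zero]
  have hHdeg : ∀ i, H.degreeOf i ≤ d - a i := fun i => by
    have h1 : MvPolynomial.degreeOf i (P * H) =
        MvPolynomial.degreeOf i P + MvPolynomial.degreeOf i H :=
      MvPolynomial.degreeOf_mul_eq hP hH0
    have h2 := degreeOf_boxPoly_le d g i
    rw [hH, h1, hPa i] at h2
    omega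
  refine ⟨fun h => H.coeff (subboxExp d a h), ?_⟩
  rw [relationMap_apply, ← eq_subboxPoly_of_degreeOf_le had hHdeg, ← hH, boxCoeff_boxPoly]

/-- **Proposition BE — exactness.**  If `P ≠ 0` generates the relation ideal of `x` and has
multidegree `a ≤ (d, …, d)`, then `dim_ℚ ⟨Box_d(x)⟩ + ∏ᵢ (d + 1 − aᵢ) = (d + 1)ⁿ`: the cap of
`finrank_span_box_add_le_of_relation` is attained. -/
theorem finrank_span_box_add_eq_of_generator {x : Fin n → ℝ} {d : ℕ} {a : Fin n → ℕ}
    (had : ∀ i, a i ≤ d) {P : MvPolynomial (Fin n) ℚ} (hP : P ≠ 0)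
    (hPa : ∀ i, P.degreeOf i = a i) (hgen : relationIdeal x = Ideal.span {P}) :
    Module.finrank ℚ (Submodule.span ℚ (Set.range (boxMonomial x d))) + ∏ i, (d + 1 - a i) =
      (d + 1) ^ n := by
  classical
  obtain ⟨hPx, hdiv⟩ := (relationIdeal_eq_span_iff x P).mp hgen
  rw [← Fintype.range_linearCombination ℚ (boxMonomial x d)]
  set Φ := Fintype.linearCombination ℚ (boxMonomial x d) with hΦ
  have hrank : Module.finrank ℚ (LinearMap.range Φ) + Module.finrank ℚ (LinearMap.ker Φ) =
      (d + 1) ^ n := by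
    rw [LinearMap.finrank_range_add_finrank_ker Φ, Module.finrank_fintype_fun_eq_card,
      Fintype.card_fun, Fintype.card_fin, Fintype.card_fin]
  rw [← hrank, add_right_inj]
  have hker : ∀ c, relationMap d a P c ∈ LinearMap.ker Φ :=
    relationMap_mem_ker had (fun i => (hPa i).le) hPx
  have hbij : Function.Bijective
      (LinearMap.codRestrict (LinearMap.ker Φ) (relationMap d a P) hker) := by
    refine ⟨fun c c' h => relationMap_injective had hP (fun i => (hPa i).le)
      (congrArg Subtype.val h), ?_⟩
    rintro ⟨g, hg⟩
    obtain ⟨c, hc⟩ := exists_relationMap_eq_of_relation had hP hPa hdiv (LinearMap.mem_ker.mp hg)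
    exact ⟨c, Subtype.ext hc⟩
  rw [← (LinearEquiv.ofBijective _ hbij).finrank_eq, Module.finrank_fintype_fun_eq_card,
    Fintype.card_pi]
  simp only [Fintype.card_fin]

/-- **Proposition BE — freeness.**  If `P ≠ 0` of multidegree `a` generates the relation ideal
of `x`, then `Box_d(x)` is `ℚ`-linearly independent iff the box does not contain `a`. -/
theorem box_linearIndependent_iff_of_generator {x : Fin n → ℝ} (d : ℕ) {a : Fin n → ℕ}
    {P : MvPolynomial (Fin n) ℚ} (hP : P ≠ 0) (hPa : ∀ i, P.degreeOf i = a i)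
    (hgen : relationIdeal x = Ideal.span {P}) :
    LinearIndependent ℚ (boxMonomial x d) ↔ ∃ i, d < a i := by
  obtain ⟨hPx, hdiv⟩ := (relationIdeal_eq_span_iff x P).mp hgen
  rw [box_linearIndependent_iff_forall_eq_zero]
  constructor
  · intro h
    by_contra hlt
    push Not at hlt
    exact hP (h P (fun i => (hPa i).le.trans (hlt i)) hPx)
  · rintro ⟨i, hi⟩ R hRd hRx
    by_contra hR
    obtain ⟨H, hH⟩ := hdiv R hRx
    have hH0 : H ≠ 0 := by
      rintro rfl
      exact hR (by rw [hH, mul_zero])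
    have h1 : MvPolynomial.degreeOf i (P * H) =
        MvPolynomial.degreeOf i P + MvPolynomial.degreeOf i H :=
      MvPolynomial.degreeOf_mul_eq hP hH0
    have h2 := hRd i
    rw [hH, h1, hPa i] at h2
    omega

/-- At a point whose `j`-th coordinate is transcendental, a nonzero relation involves some
variable other than `X_j` (a polynomial in `X_j` alone vanishing at `x` would make `x_j`
algebraic). -/
theorem exists_pos_degreeOf_of_relation {x : Fin n → ℝ} {j : Fin n}
    (hj : Transcendental ℚ (x j)) {P : MvPolynomial (Fin n) ℚ} (hP : P ≠ 0)
    (hPx : MvPolynomial.aeval x P = 0) : ∃ i, i ≠ j ∧ 0 < P.degreeOf i := by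
  classical
  by_contra h
  have h' : ∀ i, i ≠ j → P.degreeOf i = 0 := fun i hij => by
    by_contra hne
    exact h ⟨i, hij, Nat.pos_of_ne_zero hne⟩
  have hvars : (↑P.vars : Set (Fin n)) ⊆ Set.range (fun _ : Fin 1 => j) := by
    intro i hi
    rw [Finset.mem_coe, MvPolynomial.mem_vars_iff_degreeOf_ne_zero] at hi
    by_cases hij : i = j
    · exact ⟨0, hij.symm⟩
    · exact absurd (h' i hij) hi
  obtain ⟨q, hq⟩ := MvPolynomial.exists_rename_eq_of_vars_subset_range P (fun _ : Fin 1 => j)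
    (fun _ _ _ => Subsingleton.elim _ _) hvars
  have hqx : MvPolynomial.aeval (fun _ : Fin 1 => x j) q = 0 := by
    have := hPx
    rw [← hq, MvPolynomial.aeval_rename] at this
    exact this
  have hind : AlgebraicIndependent ℚ (fun _ : Fin 1 => x j) :=
    (algebraicIndependent_singleton_iff (0 : Fin 1)).mpr hj
  have hq0 : q = 0 := (algebraicIndependent_iff.mp hind) q hqx
  exact hP (by rw [← hq, hq0, map_zero])

end Generator

/-! ### §4 Two variables and the boxes at `(e, π)` -/

section Two

/-- **Proposition BE, two variables.**  If `P ≠ 0` of bidegree `(a, b)` generates the relation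
ideal of `x ∈ ℝ²`, then `dim_ℚ ⟨Box_d(x)⟩ = (a + b)(d + 1) − ab` for every `d ≥ a, b`. -/
theorem finrank_span_box_eq_of_generator_two {x : Fin 2 → ℝ} {d a b : ℕ} (ha : a ≤ d)
    (hb : b ≤ d) {P : MvPolynomial (Fin 2) ℚ} (hP : P ≠ 0) (hPa : P.degreeOf 0 = a)
    (hPb : P.degreeOf 1 = b) (hgen : relationIdeal x = Ideal.span {P}) :
    Module.finrank ℚ (Submodule.span ℚ (Set.range (boxMonomial x d))) =
      (a + b) * (d + 1) - a * b := by
  have had : ∀ i : Fin 2, (![a, b] : Fin 2 → ℕ) i ≤ d := fun i => by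
    fin_cases i <;> simp [ha, hb]
  have hPab : ∀ i : Fin 2, P.degreeOf i = (![a, b] : Fin 2 → ℕ) i := fun i => by
    fin_cases i <;> simp [hPa, hPb]
  have key := finrank_span_box_add_eq_of_generator had hP hPab hgen
  have hprod : ∏ i : Fin 2, (d + 1 - (![a, b] : Fin 2 → ℕ) i) = (d + 1 - a) * (d + 1 - b) := by
    rw [Fin.prod_univ_two]
    rfl
  rw [hprod] at key
  obtain ⟨h1, h2⟩ : a ≤ d + 1 ∧ b ≤ d + 1 := ⟨by omega, by omega⟩
  have hab : a * b ≤ (a + b) * (d + 1) :=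
    (Nat.mul_le_mul_left a h2).trans (Nat.mul_le_mul_right _ (Nat.le_add_right a b))
  zify [h1, h2, hab] at key ⊢
  linear_combination key

/-- The quantised value lies in the window of Proposition BD: for `1 ≤ a, b ≤ d`,
`2d + 1 ≤ (a + b)(d + 1) − ab ≤ (d + 1)² − 1` (pure arithmetic). -/
theorem quantised_mem_window {a b d : ℕ} (ha1 : 1 ≤ a) (hb1 : 1 ≤ b) (ha : a ≤ d) (hb : b ≤ d) :
    2 * d + 1 ≤ (a + b) * (d + 1) - a * b ∧ (a + b) * (d + 1) - a * b + 1 ≤ (d + 1) ^ 2 := by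
  have hab : a * b ≤ (a + b) * (d + 1) :=
    (Nat.mul_le_mul_left a (by omega)).trans (Nat.mul_le_mul_right _ (Nat.le_add_right a b))
  have hA : (0 : ℤ) ≤ ((a : ℤ) - 1) * ((d : ℤ) + 1 - b) :=
    mul_nonneg (by omega) (by omega)
  have hB : (0 : ℤ) ≤ (d : ℤ) * ((b : ℤ) - 1) := mul_nonneg (by omega) (by omega)
  have hC : (0 : ℤ) ≤ ((d : ℤ) - a) * ((d : ℤ) - b) := mul_nonneg (by omega) (by omega)
  constructor
  · zify [hab]
    nlinarith [hA, hB]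
  · zify [hab]
    nlinarith [hC]

/-- **At `(e, π)` a nonzero relation has bidegree `≥ (1, 1)`** (each of `e`, `π` is
transcendental). -/
theorem one_le_bidegree_of_expOnePi_relation {P : MvPolynomial (Fin 2) ℚ} (hP : P ≠ 0)
    (hPx : MvPolynomial.aeval ![Real.exp 1, Real.pi] P = 0) :
    1 ≤ P.degreeOf 0 ∧ 1 ≤ P.degreeOf 1 := by
  have he : Transcendental ℚ (Real.exp 1) := transcendental_exp_one_holds
  have hpi : Transcendental ℚ Real.pi := transcendental_pi_holds
  constructor
  · obtain ⟨i, hi, hpos⟩ :=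
      exists_pos_degreeOf_of_relation (x := ![Real.exp 1, Real.pi]) (j := 1) (by simpa using hpi)
        hP hPx
    fin_cases i
    · exact hpos
    · exact absurd rfl hi
  · obtain ⟨i, hi, hpos⟩ :=
      exists_pos_degreeOf_of_relation (x := ![Real.exp 1, Real.pi]) (j := 0) (by simpa using he)
        hP hPx
    fin_cases i
    · exact absurd rfl hi
    · exact hpos

/-- **At `(e, π)`: which boxes are free under a generator.**  `Box_d(e, π)` is `ℚ`-free iff
`d < max(a, b)`. -/
theorem box_expOnePi_linearIndependent_iff_of_generator (d : ℕ) {a b : ℕ}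
    {P : MvPolynomial (Fin 2) ℚ} (hP : P ≠ 0) (hPa : P.degreeOf 0 = a) (hPb : P.degreeOf 1 = b)
    (hgen : relationIdeal ![Real.exp 1, Real.pi] = Ideal.span {P}) :
    LinearIndependent ℚ (boxMonomial ![Real.exp 1, Real.pi] d) ↔ d < max a b := by
  have hPab : ∀ i : Fin 2, P.degreeOf i = (![a, b] : Fin 2 → ℕ) i := fun i => by
    fin_cases i <;> simp [hPa, hPb]
  rw [box_linearIndependent_iff_of_generator d hP hPab hgen, lt_max_iff]
  constructor
  · rintro ⟨i, hi⟩
    fin_cases i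
    · exact Or.inl (by simpa using hi)
    · exact Or.inr (by simpa using hi)
  · rintro (h | h)
    · exact ⟨0, by simpa using h⟩
    · exact ⟨1, by simpa using h⟩

/-- **At `(e, π)`: the bilinear floor under a generator.**  `BilinearFloor ⟺ max(a, b) ≥ 2`:
the floor fails exactly when the generator is bilinear. -/
theorem bilinearFloor_iff_of_expOnePi_generator {a b : ℕ} {P : MvPolynomial (Fin 2) ℚ}
    (hP : P ≠ 0) (hPa : P.degreeOf 0 = a) (hPb : P.degreeOf 1 = b)
    (hgen : relationIdeal ![Real.exp 1, Real.pi] = Ideal.span {P}) :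
    BilinearFloor ↔ 2 ≤ max a b := by
  rw [bilinearFloor_iff_box_one, box_expOnePi_linearIndependent_iff_of_generator 1 hP hPa hPb hgen]
  constructor <;> intro h <;> omega

/-- **Proposition BE — the quantised ladder at `(e, π)`.**  Granting that the relation ideal of
`(e, π)` over `ℚ` is principal (standard commutative algebra, NOT proved in the tree: `e` is
transcendental, so the ideal is a prime of height `≤ 1` in the UFD `ℚ[X, Y]`, hence `0` or
principal [Matsumura1986, Thm 20.1]): EITHER `e` and `π` are algebraically independent (every
box free), OR there are `a, b ≥ 1` — the bidegree of the generator — with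
`BilinearFloor ⟺ max(a,b) ≥ 2` and `dim_ℚ ⟨Box_d(e, π)⟩ = (a + b)(d + 1) − ab` for every
`d ≥ max(a, b)`. -/
theorem expOnePi_box_dichotomy_of_principal
    (hB : (relationIdeal ![Real.exp 1, Real.pi]).IsPrincipal) :
    ExpOnePiAlgebraicIndependent ∨
      ∃ a b : ℕ, 1 ≤ a ∧ 1 ≤ b ∧ (BilinearFloor ↔ 2 ≤ max a b) ∧
        ∀ d : ℕ, max a b ≤ d →
          Module.finrank ℚ (Submodule.span ℚ (Set.range (boxMonomial ![Real.exp 1, Real.pi] d))) =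
            (a + b) * (d + 1) - a * b := by
  haveI := hB
  obtain ⟨P, hP'⟩ := Submodule.IsPrincipal.principal (relationIdeal ![Real.exp 1, Real.pi])
  have hgen : relationIdeal ![Real.exp 1, Real.pi] = Ideal.span {P} := hP'
  by_cases hP : P = 0
  · left
    subst hP
    rw [Ideal.span_singleton_zero, relationIdeal_eq_bot_iff] at hgen
    rw [ExpOnePiAlgebraicIndependent]
    exact hgen
  · right
    obtain ⟨ha1, hb1⟩ :=
      one_le_bidegree_of_expOnePi_relation hP ((relationIdeal_eq_span_iff _ P).mp hgen).1
    exact ⟨P.degreeOf 0, P.degreeOf 1, ha1, hb1,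
      bilinearFloor_iff_of_expOnePi_generator hP rfl rfl hgen, fun d hd =>
        finrank_span_box_eq_of_generator_two (le_of_max_le_left hd) (le_of_max_le_right hd)
          hP rfl rfl hgen⟩

end Two

end Summit.Schanuel.Schanuel.Theorems

end
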